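import Literature.Geometry.Hyperkaehler.KaehlerFormsSubalgebraInvariant
import HarnessLib

/-!
# The two lowest pieces of the subalgebra generated by the Kähler forms: `(A_𝔞)₀ = ℂ·1` and
# `(A_𝔞)₂ = {κ_u} ≅ ℍ₀ ⊗ ℂ` is `3`-dimensional (Looijenga–Lunts 1997 §2 (2.8) for the module `A_𝔞` of §4 (4.2)(iv))

Topic `Literature/Geometry/Hyperkaehler`, namespace `Literature.Geometry.Hyperkaehler.IsLinearHyperkaehler`. Lane
`lit-hodgefound` (Track 2 foundations library), prover seat p06 (generation 16), self-proposed row g16-#6; sequel of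
row g16-#4 (`KaehlerFormsSubalgebraInvariant.lean`: the complex subalgebra
`A_𝔞 = Algebra.adjoin ℂ (Set.range fun u ↦ lefschetzTwistor g₀ J u 1)` of `H•(X, ℂ) = GForm E ℂ` generated by the
Kähler forms `κ_u = L_u 1 = ω_{λ_u} ⊗ ℂ` of the induced complex structures of a hyperkähler torus is a module over
`𝔞 ≅ 𝔰𝔬(4,1)`, additively spanned by the monomials `L_{u₁} ⋯ L_{u_r} 1`, `toSubmodule_adjoin_eq_span`) and of Q1747
(`LefschetzTwistorAlgebraSO41.lean`: `u ↦ L_u` is injective, `eq_zero_of_lefschetzTwistor_eq_zero`; `𝔞₂ = {L_u} ≅ ℍ₀`).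
Theorems only; no definition, no named fact, no `sorry`.

## Source, verbatim (E. Looijenga, V. A. Lunts, *A Lie algebra attached to a projective variety*, Invent. Math. 129
(1997) 361–412 = alg-geom/9604014; held corpus text `paper:arxiv-alg-geom_9604014` p0010 L56–L66, p0017 L45–L64)

* §2 **(2.8) Lemma.** "Let `M` be an irreducible representation `M` of the Jordan–Lefschetz pair `(𝔤, h)` and let
  `n` be its depth as a Lefschetz module. Then `M` is a Jordan–Lefschetz module if and only if `dim M_{-n} = 1`. If
  these equivalent conditions are fulfilled, then the natural map `𝔤² ⊗ M_{-n} → M_{-n+2}` is an isomorphism."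
* §4 (4.2) Lemma: "(i) `(𝔤(ℍ), h)` is a Jordan–Lefschetz pair with `𝔤(ℍ)₂` canonically isomorphic to the vector
  space underlying `ℍ₀`. […] (iv) The subalgebra `M ⊂ ∧•V` generated by the `κ_J`'s is invariant under the star
  operator and `𝔤(ℍ)`, and `M[2m]` becomes a Jordan–Lefschetz module of `(𝔤(ℍ), h)` of level `m`."

## What is formalised (pointwise; `κ_u := lefschetzTwistor g₀ J u 1`, `A_𝔞 := Algebra.adjoin ℂ (range κ)`)

The two CONCLUSIONS of (2.8) for `M = A_𝔞` (whose lowest piece sits in `H⁰`, depth `n = dim_ℂ E`), proved directly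
from the monomial description of row g16-#4 — NOT via irreducibility, which is not formalised:
§1 **`dim M_{-n} = 1`**: `of_zero_eq_smul_one` (`⋀⁰ = ℂ·1`: every homogeneous form of degree `0` is a multiple of the
unit), `of_zero_apply_mem_span_one`.
§2 **`𝔤² ⊗ M_{-n} → M_{-n+2}`, `e_u ⊗ 1 ↦ κ_u`, is ONTO**: `isHomog_prod_map` (the monomial `κ_{u₁} ⋯ κ_{u_r}` has degree
`2r`), **`of_two_apply_mem_span`**: the degree-`2` component of every element of
`A_𝔞` lies in the complex span of the `κ_u` (only the monomials of length `1` contribute), and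
`span_range_le_toSubmodule_adjoin` (conversely the `κ_u` lie in `A_𝔞`).
§3 **… and INTO; `dim_ℂ (A_𝔞)₂ = 3 = dim ℍ₀`**: `fundamentalForm_twistor_eq_sum` (`ω_{λ_a} = a₀ω_I + a₁ω_J + a₂ω_K`),
`eq_zero_of_sum_smul_fundamentalForm_eq_zero` (a vanishing real combination has zero coefficients, `E ≠ 0`, from
Q1747's injectivity of `u ↦ L_u`), **`linearIndependent_kaehlerForms : LinearIndependent ℂ ![ω_I ⊗ ℂ, ω_J ⊗ ℂ, ω_K ⊗ ℂ]`**
in `H•(X, ℂ)` (real forms: real and imaginary parts separately), `span_range_eq_span_three`, and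
**`finrank_span_kaehlerForms : finrank ℂ (span ℂ (range κ)) = 3`**.

SCOPE NOTE (faithfulness). The Lemma (2.8) itself (the equivalence with irreducibility, for an arbitrary
Jordan–Lefschetz pair) and the clause "`M[2m]` becomes a Jordan–Lefschetz module of level `m`" are not formalised;
this file records, for the concrete module `A_𝔞` of (4.2)(iv), the two numerical consequences as printed.

## References

* [LooijengaLunts1997] E. Looijenga, V. A. Lunts, *A Lie algebra attached to a projective variety*, Invent. Math.
  129 (1997) 361–412, §2 (2.7)–(2.8), §4 (4.1)–(4.2).
* [Huybrechts2005] D. Huybrechts, *Complex Geometry*, Springer (2005), Prop. 1.2.26 (`L = ω ∧ ·`).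
* [Warner1983] F. W. Warner, *Foundations of Differentiable Manifolds and Lie Groups*, GTM 94 (1983), 2.6 (the
  graded exterior algebra; `⋀⁰ = ` scalars).
-/

noncomputable section

open Module Function Complex
open Literature.LinearAlgebra.Alternating
open scoped Matrix

namespace Literature.Geometry.Hyperkaehler

namespace IsLinearHyperkaehler

open Literature.Geometry.Kaehler Literature.Geometry.Kaehler.ComplexTorus

variable {E : Type*} [NormedAddCommGroup E] [NormedSpace ℂ E] [FiniteDimensional ℂ E]
  {g₀ : E →L[ℝ] E →L[ℝ] ℝ} {J : E →L[ℝ] E}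

/-! ## §1 `dim M_{-n} = 1`: the lowest piece `⋀⁰ = ℂ·1` -/

omit [FiniteDimensional ℂ E] in
/-- **`⋀⁰ = ℂ·1`**: every homogeneous graded form of degree `0` is a multiple of the unit `1` ("`dim M_{-n} = 1`" for
the lowest piece of `H•(X)[n]`). [cite: LooijengaLunts1997, §2 (2.8)] [cite: Warner1983, 2.6] -/
theorem of_zero_eq_smul_one (η : E [⋀^Fin 0]→L[ℝ] ℂ) : (GForm.of 0 η : GForm E ℂ) = (η ![]) • (1 : GForm E ℂ) := by
  rw [GForm.one_def, ← GForm.of_smul]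
  congr 1
  ext v
  rw [ContinuousAlternatingMap.smul_apply, ContinuousAlternatingMap.constOfIsEmpty_apply, smul_eq_mul, mul_one,
    Subsingleton.elim v ![]]

omit [FiniteDimensional ℂ E] in
/-- The degree-`0` component of any graded form lies on the line `ℂ·1` (so `(A_𝔞)₀ = ℂ·1`, as `1 ∈ A_𝔞`).
[cite: LooijengaLunts1997, §2 (2.8) ("dim M_{-n} = 1")] -/
theorem of_zero_apply_mem_span_one (x : GForm E ℂ) : GForm.of 0 (x 0) ∈ ℂ ∙ (1 : GForm E ℂ) := by
  rw [of_zero_eq_smul_one]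
  exact Submodule.smul_mem _ _ (Submodule.mem_span_singleton_self _)

/-! ## §2 `𝔤² ⊗ M_{-n} → M_{-n+2}` is onto: the degree-`2` part of `A_𝔞` is spanned by the `κ_u` -/

/-- The monomial `κ_{u₁} ⋯ κ_{u_r}` in the Kähler forms is homogeneous of degree `2r`. [cite: Warner1983, 2.6]
[cite: LooijengaLunts1997, §4 (4.2) (iv)] -/
theorem isHomog_prod_map (l : List (Fin 3 → ℝ)) :
    GForm.IsHomog (2 * l.length) ((l.map fun u : Fin 3 → ℝ ↦ lefschetzTwistor g₀ J u (1 : GForm E ℂ)).prod) := by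
  have hh := GForm.IsHomog.list_prod (fun _ : Fin 3 → ℝ ↦ 2) (fun u : Fin 3 → ℝ ↦ lefschetzTwistor g₀ J u (1 : GForm E ℂ)) l
    (fun u _ ↦ by rw [lefschetzTwistor_apply_one]; exact GForm.IsHomog.of _ _)
  rwa [List.map_const', List.sum_replicate, smul_eq_mul, mul_comm] at hh

/-- **The degree-`2` piece of `A_𝔞` is the complex span of the Kähler forms `κ_u`**: for `x ∈ A_𝔞`, its
homogeneous component of degree `2` lies in `span_ℂ {κ_u : u ∈ ℝ³} = 𝔞₂ · 1` — the natural map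
`𝔤² ⊗ M_{-n} → M_{-n+2}`, `e_u ⊗ 1 ↦ e_u(1) = κ_u`, is onto (only the monomials of length `1` have degree `2`).
[cite: LooijengaLunts1997, §2 (2.8), §4 (4.2) (i), (iv)] -/
theorem of_two_apply_mem_span {x : GForm E ℂ}
    (hx : x ∈ Algebra.adjoin ℂ (Set.range fun u : Fin 3 → ℝ ↦ lefschetzTwistor g₀ J u (1 : GForm E ℂ))) :
    GForm.of 2 (x 2) ∈ Submodule.span ℂ (Set.range fun u : Fin 3 → ℝ ↦ lefschetzTwistor g₀ J u (1 : GForm E ℂ)) := by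
  rw [← Subalgebra.mem_toSubmodule, toSubmodule_adjoin_eq_span] at hx
  have key : Submodule.span ℂ (Set.range fun l : List (Fin 3 → ℝ) ↦ (l.map (lefschetzTwistor g₀ J)).prod (1 : GForm E ℂ)) ≤
      (Submodule.span ℂ (Set.range fun u : Fin 3 → ℝ ↦ lefschetzTwistor g₀ J u (1 : GForm E ℂ))).comap
        (LinearMap.single ℂ (fun m : ℕ ↦ E [⋀^Fin m]→L[ℝ] ℂ) 2 ∘ₗ LinearMap.proj 2) := by
    rw [Submodule.span_le]
    rintro _ ⟨l, rfl⟩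
    rw [SetLike.mem_coe, Submodule.mem_comap]
    change GForm.of 2 (((l.map (lefschetzTwistor g₀ J)).prod (1 : GForm E ℂ)) 2) ∈ _
    rw [prod_map_lefschetzTwistor_apply_one]
    have hh := isHomog_prod_map (g₀ := g₀) (J := J) l
    match l, hh with
    | [], hh =>
      rw [hh 2 (by simp), GForm.of_zero]
      exact zero_mem _
    | [u], hh =>
      rw [List.map_singleton, List.prod_singleton, ← (show GForm.IsHomog 2 (lefschetzTwistor g₀ J u (1 : GForm E ℂ)) by
        simpa using hh).eq_of]
      exact Submodule.subset_span ⟨u, rfl⟩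
    | u :: u' :: l', hh =>
      rw [hh 2 (by simp), GForm.of_zero]
      exact zero_mem _
  exact key hx

/-! ## §3 … and into: `ω_I, ω_J, ω_K` are `ℂ`-linearly independent in `H•(X, ℂ)`, `dim_ℂ (A_𝔞)₂ = 3 = dim ℍ₀` -/

omit [FiniteDimensional ℂ E] in
/-- `ω_{λ_a} = a₀ ω_I + a₁ ω_J + a₂ ω_K` (the Kähler form is linear in the complex structure). [cite: LooijengaLunts1997, §4 (4.1) ("J ↦ κ_J extends linearly to ℍ₀")] -/
theorem fundamentalForm_twistor_eq_sum (a : Fin 3 → ℝ) :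
    fundamentalForm g₀ (a 0 • opI E + a 1 • J + a 2 • opK J) =
      a 0 • fundamentalForm g₀ (opI E) + a 1 • fundamentalForm g₀ J + a 2 • fundamentalForm g₀ (opK J) := by
  rw [fundamentalForm_add, fundamentalForm_add, fundamentalForm_smul, fundamentalForm_smul, fundamentalForm_smul]

/-- A vanishing real combination `a₀ω_I + a₁ω_J + a₂ω_K = 0` has `a = 0` (`E ≠ 0`; Q1747: `u ↦ L_u` is injective,
`ω_{λ_u}` is non-degenerate for `u ≠ 0`). [cite: LooijengaLunts1997, §4 (4.1)–(4.2) (i) ("this extension is an isomorphism of ℍ₀ onto a space of … 2-forms")] -/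
theorem eq_zero_of_sum_smul_fundamentalForm_eq_zero [Nontrivial E] (h : IsLinearHyperkaehler g₀ J) {a : Fin 3 → ℝ}
    (ha : a 0 • fundamentalForm g₀ (opI E) + a 1 • fundamentalForm g₀ J + a 2 • fundamentalForm g₀ (opK J) = 0) :
    a = 0 := by
  apply h.eq_zero_of_lefschetzTwistor_eq_zero
  rw [lefschetzTwistor_apply, fundamentalForm_twistor_eq_sum, ha, ← zero_smul ℝ (0 : E [⋀^Fin 2]→L[ℝ] ℝ),
    lefschetzG_smul, zero_smul]

/-- **`ω_I ⊗ ℂ, ω_J ⊗ ℂ, ω_K ⊗ ℂ` are `ℂ`-linearly independent in `H•(X, ℂ)`** (`E ≠ 0`): a complex relation splits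
into two real ones (the forms are real), each trivial by `eq_zero_of_sum_smul_fundamentalForm_eq_zero` — the map
`𝔤² ⊗ M_{-n} → M_{-n+2}` is into. [cite: LooijengaLunts1997, §2 (2.8), §4 (4.2) (i)] -/
theorem linearIndependent_kaehlerForms [Nontrivial E] (h : IsLinearHyperkaehler g₀ J) :
    LinearIndependent ℂ ![(GForm.of 2 (ofRealForm (fundamentalForm g₀ (opI E))) : GForm E ℂ),
      GForm.of 2 (ofRealForm (fundamentalForm g₀ J)), GForm.of 2 (ofRealForm (fundamentalForm g₀ (opK J)))] := by
  rw [Fintype.linearIndependent_iff]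
  intro c hc
  rw [Fin.sum_univ_three] at hc
  simp only [Matrix.cons_val_zero, Matrix.cons_val_one, Matrix.cons_val] at hc
  rw [← GForm.of_smul, ← GForm.of_smul, ← GForm.of_smul, ← GForm.of_add, ← GForm.of_add, GForm.of_eq_zero_iff] at hc
  -- hc : c 0 • ω_I^ℂ + c 1 • ω_J^ℂ + c 2 • ω_K^ℂ = 0 (complex 2-forms)
  have hv : ∀ v : Fin 2 → E, c 0 * (fundamentalForm g₀ (opI E) v : ℂ) + c 1 * (fundamentalForm g₀ J v : ℂ) +
      c 2 * (fundamentalForm g₀ (opK J) v : ℂ) = 0 := fun v ↦ by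
    have e := congr_arg (fun φ : E [⋀^Fin 2]→L[ℝ] ℂ ↦ φ v) hc
    simpa using e
  have hre : (fun i ↦ (c i).re) = 0 := by
    apply h.eq_zero_of_sum_smul_fundamentalForm_eq_zero
    ext v
    have e := congr_arg Complex.re (hv v)
    simpa using e
  have him : (fun i ↦ (c i).im) = 0 := by
    apply h.eq_zero_of_sum_smul_fundamentalForm_eq_zero
    ext v
    have e := congr_arg Complex.im (hv v)
    simpa using e
  intro i
  exact Complex.ext (congr_fun hre i) (congr_fun him i)

/-- `span_ℂ {κ_u : u ∈ ℝ³} = span_ℂ {ω_I, ω_J, ω_K}` (`κ_u = u₀ω_I + u₁ω_J + u₂ω_K`, Q1747 `lefschetzTwistor_eq_sum`).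
[cite: LooijengaLunts1997, §4 (4.1)] -/
theorem span_range_eq_span_three :
    Submodule.span ℂ (Set.range fun u : Fin 3 → ℝ ↦ lefschetzTwistor g₀ J u (1 : GForm E ℂ)) =
      Submodule.span ℂ (Set.range ![(GForm.of 2 (ofRealForm (fundamentalForm g₀ (opI E))) : GForm E ℂ),
        GForm.of 2 (ofRealForm (fundamentalForm g₀ J)), GForm.of 2 (ofRealForm (fundamentalForm g₀ (opK J)))]) := by
  apply le_antisymm
  · rw [Submodule.span_le]
    rintro _ ⟨u, rfl⟩
    have e := LinearMap.congr_fun (lefschetzTwistor_eq_sum (g₀ := g₀) (J := J) u) (1 : GForm E ℂ)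
    rw [SetLike.mem_coe]
    beta_reduce
    rw [e]
    simp only [LinearMap.add_apply, LinearMap.smul_apply, lefschetzG_one_eq_of, RCLike.real_smul_eq_coe_smul (K := ℂ)]
    refine add_mem (add_mem (Submodule.smul_mem _ _ (Submodule.subset_span ⟨0, rfl⟩))
      (Submodule.smul_mem _ _ (Submodule.subset_span ⟨1, rfl⟩))) (Submodule.smul_mem _ _ (Submodule.subset_span ⟨2, rfl⟩))
  · rw [Submodule.span_le]
    rintro _ ⟨i, rfl⟩
    rw [SetLike.mem_coe]
    fin_cases i
    · refine Submodule.subset_span ⟨Pi.single 0 1, ?_⟩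
      beta_reduce
      rw [lefschetzTwistor_single_zero, lefschetzG_one_eq_of]
      rfl
    · refine Submodule.subset_span ⟨Pi.single 1 1, ?_⟩
      beta_reduce
      rw [lefschetzTwistor_single_one (g₀ := g₀), lefschetzG_one_eq_of]
      rfl
    · refine Submodule.subset_span ⟨Pi.single 2 1, ?_⟩
      beta_reduce
      rw [lefschetzTwistor_single_two (g₀ := g₀), lefschetzG_one_eq_of]
      rfl

/-- **`dim_ℂ (A_𝔞)₂ = 3 = dim ℍ₀ = dim 𝔞₂`**: the natural map `𝔤² ⊗ M_{-n} → M_{-n+2}` is an isomorphism for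
`M = A_𝔞` (`E ≠ 0`). [cite: LooijengaLunts1997, §2 (2.8), §4 (4.2) (i)] -/
theorem finrank_span_kaehlerForms [Nontrivial E] (h : IsLinearHyperkaehler g₀ J) :
    Module.finrank ℂ (Submodule.span ℂ (Set.range fun u : Fin 3 → ℝ ↦ lefschetzTwistor g₀ J u (1 : GForm E ℂ))) = 3 := by
  rw [span_range_eq_span_three, finrank_span_eq_card h.linearIndependent_kaehlerForms, Fintype.card_fin]

/-- Conversely the span of the `κ_u` is contained in `A_𝔞` (so `(A_𝔞)₂` IS this span, with `of_two_apply_mem_span`).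
[cite: LooijengaLunts1997, §4 (4.2) (iv)] -/
theorem span_range_le_toSubmodule_adjoin :
    Submodule.span ℂ (Set.range fun u : Fin 3 → ℝ ↦ lefschetzTwistor g₀ J u (1 : GForm E ℂ)) ≤
      Subalgebra.toSubmodule (Algebra.adjoin ℂ (Set.range fun u : Fin 3 → ℝ ↦ lefschetzTwistor g₀ J u (1 : GForm E ℂ))) := by
  rw [Algebra.adjoin_eq_span]
  exact Submodule.span_mono Submonoid.subset_closure

end IsLinearHyperkaehler

end Literature.Geometry.Hyperkaehler

end
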